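import Literature.Probability.RandomPlanarGeometry.HexSAWStripWidthTwoContactSkewness
import Literature.Probability.RandomPlanarGeometry.HexSAWStripWidthTwoHatFourthContactAnnihilator
import Literature.Analysis.Asymptotics.LinearRecurrenceCubicSource
import HarnessLib

/-!
# The width-two strip at criticality: the fourth-power contact sums `Ĉ⁴(n+1)_{ab}` of `S₂` grow QUARTICALLY with forced leading coefficient `c⁴A`, and the
# Bell-polynomial constant `κ̂₄(T = 2)` (module «WIDTH-TWO FOURTH CONTACT MOMENT»)

Topic `Literature/Probability/RandomPlanarGeometry` (continues «WIDTH-TWO CONTACT SKEWNESS» — `W2.exists_hatC3D_two_cubic`, `W2.kappaHatTwo` (`κ̂₃`), `W2.cDetTwo`,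
`W2.cTwoDetTwo`, `W2.linQTwoDet`, `W2.cubA/B/CTwoDet`, the scalars and their closed forms —, «WIDTH-TWO HAT FOURTH CONTACT ANNIHILATOR» (`W2.hatC4DTwo`,
`W2.detYTwo_contact_fourth_annihilator`) and the model-free «LINEAR RECURRENCE WITH CUBIC SOURCE»
(`Literature.Analysis.exists_abs_sub_quartic_le_of_linearRecurrence_one_real`)).  Lane «pcv-sawmu» (CriticalPhenomena venture), a-p2 g29.  Fourth `y∂_y` of
`det P(λ; y)·(bridge sums) = 0`: `Σ t_r Ĉ⁴ = −4Σ ṫĈ³ − 6Σ ṫĈ² − 4Σ ṫĈ − Σ ṫD̂`, a CUBIC polynomial source up to `(n+1)⁹Rⁿ` by the three lower moment laws, hence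
(car «CUBIC SOURCE») `Ĉ⁴(n+1) = (α₄/4)n⁴ + … + m₄ + O((n+1)^{12}Rⁿ)`.  THE BELL FORMULA defining `κ̂₄`: with the plain power moments
`M_{ij} = Σ_r r^i (y∂_y)^j t_r` of `det(λ − G₂(y))` at `(1, y₂)` (`M₂₀ = T_λλ + T_λ`, `M₃₀ = T_λλλ + 3T_λλ + T_λ`, `M₄₀ = T₄ + 6T_λλλ + 7T_λλ + T_λ`,
`M_{i,j≥1} = Σ r^i ṫ_r`) the cumulants `L_j` of `log λ(y₂e^t)` per hat index satisfy
`L₄M₁₀ + 4L₃(L₁M₂₀ + M₁₁) + 3L₂²M₂₀ + 6L₂(L₁²M₃₀ + 2L₁M₂₁ + M₁₂) + L₁⁴M₄₀ + 4L₁³M₃₁ + 6L₁²M₂₂ + 4L₁M₁₃ + M₀₄ = 0` (`L₁ = cDetTwo`, `L₂ = cTwoDetTwo − cDetTwo²`,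
`L₃ = kappaHatTwo`).  Frame: W. Feller I (1968) XIII.6; R. P. Stanley EC1 §4.1; nothing below is printed.

## What is proved (namespace `…SAW.HV.W2`)
* §1 `trrryTwo` (`Σ r³ṫ_r = −194/7 + 135x²/7`), `tFourTwo` (`Σ r(r−1)(r−2)(r−3)t_r = 24`), `sum_coeff_cube_qMonicTwo` (`Σ j³Q_j = T₄/4 + T_λλλ + T_λλ/2`).
* §2 `pThree/pTwo/pOneTwoDet` (the cubic law in `n`-indexing), `quartSrc0…3TwoDet`, `quartA/B/C/DTwoDet` (source data and quartic-law constants);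
  ★ `kappaHatFourTwo` (`L₄` by the Bell formula), `kappaStepFourTwo := κ̂₄/2`; `fourthTopTwo` (`m₄ − 3Var²` of the contact count under the critical weights,
  in the raw ratios `Ĉ⁴/D̂ − 4(Ĉ³/D̂)(Ĉ/D̂) − 3(Ĉ²/D̂)² + 12(Ĉ²/D̂)(Ĉ/D̂)² − 6(Ĉ/D̂)⁴`).
* §3 `hatC4D_two_source`, `hatC4D_two_recurrence_bound`, ★★★ **`exists_hatC4D_two_quartic`** (the quartic law with errors `K(n+1)^{12}Rⁿ`).
The kurtosis law and the exact value `κ₄(T=2) = (3339420 − 2361331√2)/32` follow in «WIDTH-TWO CONTACT KURTOSIS».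

Label: LANE THEOREM (own result of lane «pcv-sawmu», a-p2 g29, 2026-08-28; not in print).
-/

noncomputable section

open Finset Filter Topology Matrix Polynomial Literature.Probability.LatticeModels Literature.Probability.Percolation

namespace Literature.Probability.RandomPlanarGeometry.SAW

namespace HV

namespace W2

/-! ## §1 Two more scalars and `Σ j³Q_j` -/

/-- `Σ_r r³·ṫ_r(y₂)`. [cite: Feller1968, XIII.6; lane «pcv-sawmu» a-p2 g29] -/
def trrryTwo : ℝ := ∑ r ∈ range 5, (r : ℝ) ^ 3 * detYTwoDot (stripYT 2) r

/-- `T₄ := Σ_r r(r−1)(r−2)(r−3)·t_r(y₂)` (`= 24`, only `r = 4` contributes). [cite: Stanley2012EC1, §4.1; lane «pcv-sawmu» a-p2 g29] -/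
def tFourTwo : ℝ := ∑ r ∈ range 5, (r : ℝ) * ((r : ℝ) - 1) * ((r : ℝ) - 2) * ((r : ℝ) - 3) * detYTwo (stripYT 2) r

/-- `Σr³ṫ = −194/7 + 135x²/7`. [cite: Stanley2012EC1, §4.1; lane «pcv-sawmu» a-p2 g29 — own computation] -/
theorem trrryTwo_eq : trrryTwo = -194 / 7 + 135 / 7 * hexCriticalFugacity ^ 2 := by
  simp only [trrryTwo, Finset.sum_range_succ, Finset.sum_range_zero, detYTwoDot, stripYT_two, sqrt_two_eq]
  push_cast
  linear_combination ((194/7 : ℝ) + (-61/7 : ℝ) * hexCriticalFugacity ^ 2 + (8/7 : ℝ) * hexCriticalFugacity ^ 4) * xc_minpoly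

/-- `T₄ = 24`. [cite: Stanley2012EC1, §4.1; lane plumbing] -/
theorem tFourTwo_eq : tFourTwo = 24 := by
  simp only [tFourTwo, Finset.sum_range_succ, Finset.sum_range_zero, detYTwo]
  push_cast
  ring

/-- `Σ_j j³·Q_j = κ + 8p + 27 = T₄/4 + T_λλλ + T_λλ/2`. [cite: Stanley2012EC1, §4.1; lane plumbing] -/
theorem sum_coeff_cube_qMonicTwo :
    ∑ j ∈ range (qMonicTwo.natDegree + 1), qMonicTwo.coeff j * (j : ℂ) ^ 3 = ((tFourTwo / 4 + tThreeTwo + tTwoTwo / 2 : ℝ) : ℂ) := by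
  obtain ⟨h0, h1, h2, h3⟩ := qMonicTwo_coeff
  rw [qMonicTwo_monic.2]
  simp only [Finset.sum_range_succ, Finset.sum_range_zero, h0, h1, h2, h3, zero_add, tFourTwo_eq, tThreeTwo_eq, tTwoTwo_eq, pTwo, kTwo]
  push_cast
  ring

/-! ## §2 Constants and the statistic -/

/-- Leading coefficients of the cubic law of `Ĉ³(n+1)` in `n`-indexing: `p₃ = α/3`, `p₂ = (β−α)/2`, `p₁ = α/6 − β/2 + γ` (plumbing). [cite: Feller1968, XIII.6; lane «pcv-sawmu» a-p2 g29] -/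
def pThreeTwoDet (A : ℝ) : ℝ := cubATwoDet A / 3
/-- see `pThreeTwoDet`. [cite: Feller1968, XIII.6; lane «pcv-sawmu» a-p2 g29] -/
def pTwoTwoDet (A m₀ : ℝ) : ℝ := (cubBTwoDet A m₀ - cubATwoDet A) / 2
/-- see `pThreeTwoDet`. [cite: Feller1968, XIII.6; lane «pcv-sawmu» a-p2 g29] -/
def pOneTwoDet (A m₀ m₂ : ℝ) : ℝ := cubATwoDet A / 6 - cubBTwoDet A m₀ / 2 + cubCTwoDet A m₀ m₂

/-- Source coefficients of the `Ĉ⁴` recurrence: `ℓ₃ˢ = −4p₃T_y`. [cite: Feller1968, XIII.6; lane «pcv-sawmu» a-p2 g29] -/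
def quartSrc3TwoDet (A : ℝ) : ℝ := -4 * pThreeTwoDet A * tyTwo
/-- `ℓ₂ˢ = −4(3p₃T_λy + p₂T_y) − 6c²A·T_y`. [cite: Feller1968, XIII.6; lane «pcv-sawmu» a-p2 g29] -/
def quartSrc2TwoDet (A m₀ : ℝ) : ℝ := -4 * (3 * pThreeTwoDet A * tlyTwo + pTwoTwoDet A m₀ * tyTwo) - 6 * (cDetTwo ^ 2 * A) * tyTwo
/-- `ℓ₁ˢ = −4(3p₃Σr²ṫ + 2p₂T_λy + p₁T_y) − 6(2c²A·T_λy + ℓT_y) − 4cA·T_y`. [cite: Feller1968, XIII.6; lane «pcv-sawmu» a-p2 g29] -/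
def quartSrc1TwoDet (A m₀ m₂ : ℝ) : ℝ :=
  -4 * (3 * pThreeTwoDet A * trryTwo + 2 * pTwoTwoDet A m₀ * tlyTwo + pOneTwoDet A m₀ m₂ * tyTwo)
    - 6 * (2 * (cDetTwo ^ 2 * A) * tlyTwo + linQTwoDet A m₀ * tyTwo) - 4 * (cDetTwo * A) * tyTwo
/-- `ℓ₀ˢ = −4(p₃Σr³ṫ + p₂Σr²ṫ + p₁T_λy + m₃T_y) − 6(c²AΣr²ṫ + ℓT_λy + m₂T_y) − 4(cA·T_λy + m₀T_y) − T_y·A`. [cite: Feller1968, XIII.6; lane «pcv-sawmu» a-p2 g29] -/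
def quartSrc0TwoDet (A m₀ m₂ m₃ : ℝ) : ℝ :=
  -4 * (pThreeTwoDet A * trrryTwo + pTwoTwoDet A m₀ * trryTwo + pOneTwoDet A m₀ m₂ * tlyTwo + m₃ * tyTwo)
    - 6 * ((cDetTwo ^ 2 * A) * trryTwo + linQTwoDet A m₀ * tlyTwo + m₂ * tyTwo) - 4 * ((cDetTwo * A) * tlyTwo + m₀ * tyTwo) - tyTwo * A

/-- `α₄ = ℓ₃ˢ/T_λ`. [cite: Stanley2012EC1, §4.1; lane «pcv-sawmu» a-p2 g29] -/
def quartATwoDet (A : ℝ) : ℝ := quartSrc3TwoDet A / tOneTwo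
/-- `β₄ = (ℓ₂ˢ − 3α₄·T_λλ/2)/T_λ`. [cite: Stanley2012EC1, §4.1; lane «pcv-sawmu» a-p2 g29] -/
def quartBTwoDet (A m₀ : ℝ) : ℝ := (quartSrc2TwoDet A m₀ - 3 * quartATwoDet A * (tTwoTwo / 2)) / tOneTwo
/-- `γ₄ = (ℓ₁ˢ − 3α₄Q_dd − 2β₄Q_d)/T_λ`. [cite: Stanley2012EC1, §4.1; lane «pcv-sawmu» a-p2 g29] -/
def quartCTwoDet (A m₀ m₂ : ℝ) : ℝ :=
  (quartSrc1TwoDet A m₀ m₂ - 3 * quartATwoDet A * (tThreeTwo / 3 + tTwoTwo / 2) - 2 * quartBTwoDet A m₀ * (tTwoTwo / 2)) / tOneTwo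
/-- `δ₄ = (ℓ₀ˢ − α₄Q_ddd − β₄Q_dd − γ₄Q_d)/T_λ`. [cite: Stanley2012EC1, §4.1; lane «pcv-sawmu» a-p2 g29] -/
def quartDTwoDet (A m₀ m₂ m₃ : ℝ) : ℝ :=
  (quartSrc0TwoDet A m₀ m₂ m₃ - quartATwoDet A * (tFourTwo / 4 + tThreeTwo + tTwoTwo / 2) - quartBTwoDet A m₀ * (tThreeTwo / 3 + tTwoTwo / 2)
    - quartCTwoDet A m₀ m₂ * (tTwoTwo / 2)) / tOneTwo

/-- ★ `κ̂₄(T=2)` by the Bell formula of the module docstring (`L₁ = cDetTwo`, `L₂ = cTwoDetTwo − cDetTwo²`, `L₃ = kappaHatTwo`; plain power moments from the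
falling-factorial scalars). [cite: Feller1968, XIII.6; lane «pcv-sawmu» a-p2 g29] -/
def kappaHatFourTwo : ℝ :=
  -(4 * kappaHatTwo * (cDetTwo * (tTwoTwo + tOneTwo) + tlyTwo) + 3 * (cTwoDetTwo - cDetTwo ^ 2) ^ 2 * (tTwoTwo + tOneTwo)
      + 6 * (cTwoDetTwo - cDetTwo ^ 2) * (cDetTwo ^ 2 * (tThreeTwo + 3 * tTwoTwo + tOneTwo) + 2 * cDetTwo * trryTwo + tlyTwo)
      + cDetTwo ^ 4 * (tFourTwo + 6 * tThreeTwo + 7 * tTwoTwo + tOneTwo) + 4 * cDetTwo ^ 3 * trrryTwo + 6 * cDetTwo ^ 2 * trryTwo + 4 * cDetTwo * tlyTwo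
      + tyTwo) / tOneTwo

/-- ★ `κ₄(T=2) := κ̂₄/2` per step. [cite: Feller1968, XIII.6; lane «pcv-sawmu» a-p2 g29] -/
def kappaStepFourTwo : ℝ := kappaHatFourTwo / 2

/-- The fourth cumulant statistic `m₄ − 3Var²` of the number of surface contacts of a bridge `a → b` of `S₂` with hat index `k` under the critical weights,
written in the raw ratios: `Ĉ⁴/D̂ − 4(Ĉ³/D̂)(Ĉ/D̂) − 3(Ĉ²/D̂)² + 12(Ĉ²/D̂)(Ĉ/D̂)² − 6(Ĉ/D̂)⁴`. [cite: Feller1968, XIII.6; lane «pcv-sawmu» a-p2 g29] -/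
def fourthTopTwo (k : ℕ) (a b : Fin (2 * 2)) : ℝ :=
  hatC4DTwo (stripYT 2) k a b / hatD 2 (stripYT 2) k a b - 4 * (hatC3DTwo (stripYT 2) k a b / hatD 2 (stripYT 2) k a b) * meanTopTwo k a b
    - 3 * (hatC2D (stripYT 2) k a b / hatD 2 (stripYT 2) k a b) ^ 2 + 12 * (hatC2D (stripYT 2) k a b / hatD 2 (stripYT 2) k a b) * meanTopTwo k a b ^ 2
    - 6 * meanTopTwo k a b ^ 4

/-! ## §3 The quartic law of `Ĉ⁴` -/

/-- The source of the `Ĉ⁴` recurrence of `S₂` in terms of the lower-moment errors (from `detYTwo_contact_fourth_annihilator`; `ẗ = t⃛ = t⁗ = ṫ`).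
[cite: Feller1968, XIII.6; lane «pcv-sawmu» a-p2 g29] -/
theorem hatC4D_two_source (a b : Fin (2 * 2)) (m₀ m₂ m₃ : ℝ) (n : ℕ) :
    ∑ r ∈ range 5, detYTwo (stripYT 2) r * hatC4DTwo (stripYT 2) (n + r + 1) a b
        - (quartSrc3TwoDet (limTwo a b) * (n : ℝ) ^ 3 + quartSrc2TwoDet (limTwo a b) m₀ * (n : ℝ) ^ 2
          + quartSrc1TwoDet (limTwo a b) m₀ m₂ * (n : ℝ) + quartSrc0TwoDet (limTwo a b) m₀ m₂ m₃)
      = -(4 * ∑ r ∈ range 5, detYTwoDot (stripYT 2) r * (hatC3DTwo (stripYT 2) (n + r + 1) a b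
            - (pThreeTwoDet (limTwo a b) * ((n + r : ℕ) : ℝ) ^ 3 + pTwoTwoDet (limTwo a b) m₀ * ((n + r : ℕ) : ℝ) ^ 2
              + pOneTwoDet (limTwo a b) m₀ m₂ * ((n + r : ℕ) : ℝ) + m₃))
          + 6 * ∑ r ∈ range 5, detYTwoDot (stripYT 2) r * (hatC2D (stripYT 2) (n + r + 1) a b
            - (cDetTwo ^ 2 * limTwo a b * ((n + r : ℕ) : ℝ) ^ 2 + linQTwoDet (limTwo a b) m₀ * ((n + r : ℕ) : ℝ) + m₂))
          + 4 * ∑ r ∈ range 5, detYTwoDot (stripYT 2) r * (hatCD (stripYT 2) (n + r + 1) a b - (cDetTwo * limTwo a b * ((n + r : ℕ) : ℝ) + m₀))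
          + ∑ r ∈ range 5, detYTwoDot (stripYT 2) r * (hatD 2 (stripYT 2) (n + r + 1) a b - limTwo a b)) := by
  have hy : 0 < stripYT 2 := stripYT_pos (by norm_num)
  have h := detYTwo_contact_fourth_annihilator hy a b n
  set A := limTwo a b with hA
  set ℓ := linQTwoDet A m₀ with hℓ
  set p₃ := pThreeTwoDet A with hp₃
  set p₂ := pTwoTwoDet A m₀ with hp₂
  set p₁ := pOneTwoDet A m₀ m₂ with hp₁
  have e3 : ∑ r ∈ range 5, detYTwoDot (stripYT 2) r * (hatC3DTwo (stripYT 2) (n + r + 1) a b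
        - (p₃ * ((n + r : ℕ) : ℝ) ^ 3 + p₂ * ((n + r : ℕ) : ℝ) ^ 2 + p₁ * ((n + r : ℕ) : ℝ) + m₃))
      = ∑ r ∈ range 5, detYTwoDot (stripYT 2) r * hatC3DTwo (stripYT 2) (n + 1 + r) a b
        - (p₃ * ((n : ℝ) ^ 3 * tyTwo + 3 * (n : ℝ) ^ 2 * tlyTwo + 3 * (n : ℝ) * trryTwo + trrryTwo)
          + p₂ * ((n : ℝ) ^ 2 * tyTwo + 2 * (n : ℝ) * tlyTwo + trryTwo) + p₁ * ((n : ℝ) * tyTwo + tlyTwo) + m₃ * tyTwo) := by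
    rw [tyTwo, tlyTwo, trryTwo, trrryTwo]
    simp only [Finset.mul_sum, ← Finset.sum_add_distrib, ← Finset.sum_sub_distrib, mul_add]
    refine Finset.sum_congr rfl fun r _ => ?_
    rw [show n + r + 1 = n + 1 + r by ring]; push_cast; ring
  have e2 : ∑ r ∈ range 5, detYTwoDot (stripYT 2) r * (hatC2D (stripYT 2) (n + r + 1) a b
        - (cDetTwo ^ 2 * A * ((n + r : ℕ) : ℝ) ^ 2 + ℓ * ((n + r : ℕ) : ℝ) + m₂))
      = ∑ r ∈ range 5, detYTwoDot (stripYT 2) r * hatC2D (stripYT 2) (n + 1 + r) a b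
        - (cDetTwo ^ 2 * A * ((n : ℝ) ^ 2 * tyTwo + 2 * (n : ℝ) * tlyTwo + trryTwo) + ℓ * ((n : ℝ) * tyTwo + tlyTwo) + m₂ * tyTwo) := by
    rw [tyTwo, tlyTwo, trryTwo]
    simp only [Finset.mul_sum, ← Finset.sum_add_distrib, ← Finset.sum_sub_distrib, mul_add]
    refine Finset.sum_congr rfl fun r _ => ?_
    rw [show n + r + 1 = n + 1 + r by ring]; push_cast; ring
  have e1 : ∑ r ∈ range 5, detYTwoDot (stripYT 2) r * (hatCD (stripYT 2) (n + r + 1) a b - (cDetTwo * A * ((n + r : ℕ) : ℝ) + m₀))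
      = ∑ r ∈ range 5, detYTwoDot (stripYT 2) r * hatCD (stripYT 2) (n + 1 + r) a b - (cDetTwo * A * ((n : ℝ) * tyTwo + tlyTwo) + m₀ * tyTwo) := by
    rw [tyTwo, tlyTwo]
    simp only [Finset.mul_sum, ← Finset.sum_add_distrib, ← Finset.sum_sub_distrib, mul_add]
    refine Finset.sum_congr rfl fun r _ => ?_
    rw [show n + r + 1 = n + 1 + r by ring]; push_cast; ring
  have e0 : ∑ r ∈ range 5, detYTwoDot (stripYT 2) r * (hatD 2 (stripYT 2) (n + r + 1) a b - A)
      = ∑ r ∈ range 5, detYTwoDot (stripYT 2) r * hatD 2 (stripYT 2) (n + 1 + r) a b - tyTwo * A := by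
    rw [tyTwo, Finset.sum_mul, ← Finset.sum_sub_distrib]
    exact Finset.sum_congr rfl fun r _ => by rw [show n + r + 1 = n + 1 + r by ring]; ring
  have e4 : ∑ r ∈ range 5, detYTwo (stripYT 2) r * hatC4DTwo (stripYT 2) (n + r + 1) a b
      = ∑ r ∈ range 5, detYTwo (stripYT 2) r * hatC4DTwo (stripYT 2) (n + 1 + r) a b :=
    Finset.sum_congr rfl fun r _ => by rw [show n + r + 1 = n + 1 + r by ring]
  rw [e3, e2, e1, e0, e4, quartSrc3TwoDet, quartSrc2TwoDet, quartSrc1TwoDet, quartSrc0TwoDet]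
  linear_combination h

/-- The recurrence-with-source estimate for `Ĉ⁴(n+1)_{ab}` of `S₂`. [cite: Feller1968, XIII.6; Stanley2012EC1, §4.1 Theorem 4.1.1 (iii); lane «pcv-sawmu» a-p2 g29] -/
theorem hatC4D_two_recurrence_bound (a b : Fin (2 * 2)) {m₀ m₂ m₃ K₁ : ℝ} (hK₁ : 0 ≤ K₁)
    (hb₁ : ∀ n : ℕ, |hatCD (stripYT 2) (n + 1) a b - (cDetTwo * limTwo a b * (n : ℝ) + m₀)| ≤ K₁ * ((n : ℝ) + 1) ^ 3 * rTwoDet ^ n)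
    (hb₂ : ∀ n : ℕ, |hatC2D (stripYT 2) (n + 1) a b - (cDetTwo ^ 2 * limTwo a b * (n : ℝ) ^ 2 + linQTwoDet (limTwo a b) m₀ * (n : ℝ) + m₂)|
      ≤ K₁ * ((n : ℝ) + 1) ^ 6 * rTwoDet ^ n)
    (hb₃ : ∀ n : ℕ, |hatC3DTwo (stripYT 2) (n + 1) a b - (pThreeTwoDet (limTwo a b) * (n : ℝ) ^ 3 + pTwoTwoDet (limTwo a b) m₀ * (n : ℝ) ^ 2
      + pOneTwoDet (limTwo a b) m₀ m₂ * (n : ℝ) + m₃)| ≤ K₁ * ((n : ℝ) + 1) ^ 9 * rTwoDet ^ n) :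
    ∃ K : ℝ, 0 ≤ K ∧ ∀ n : ℕ,
    ‖∑ j ∈ range (qMonicTwo.natDegree + 1), qMonicTwo.coeff j
        * (((hatC4DTwo (stripYT 2) (n + 1 + j + 1) a b : ℝ) : ℂ) - ((hatC4DTwo (stripYT 2) (n + j + 1) a b : ℝ) : ℂ))
        - (((quartSrc3TwoDet (limTwo a b) : ℝ) : ℂ) * (n : ℂ) ^ 3 + ((quartSrc2TwoDet (limTwo a b) m₀ : ℝ) : ℂ) * (n : ℂ) ^ 2
          + ((quartSrc1TwoDet (limTwo a b) m₀ m₂ : ℝ) : ℂ) * (n : ℂ) + ((quartSrc0TwoDet (limTwo a b) m₀ m₂ m₃ : ℝ) : ℂ))‖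
      ≤ K * ((n : ℝ) + 1) ^ 9 * rTwoDet ^ n := by
  obtain ⟨hR0, hR1, -, -⟩ := rTwoDet_facts
  obtain ⟨K₀, hK₀', hK₀⟩ := abs_hatD_two_sub_lim_le
  set S₃ : ℝ := K₁ * ∑ r ∈ range 5, |detYTwoDot (stripYT 2) r| * ((r : ℝ) + 1) ^ 9 with hS₃
  set S₂ : ℝ := K₁ * ∑ r ∈ range 5, |detYTwoDot (stripYT 2) r| * ((r : ℝ) + 1) ^ 6 with hS₂
  set S₁ : ℝ := K₁ * ∑ r ∈ range 5, |detYTwoDot (stripYT 2) r| * ((r : ℝ) + 1) ^ 3 with hS₁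
  set S₀ : ℝ := K₀ * ∑ r ∈ range 5, |detYTwoDot (stripYT 2) r| * ((r : ℝ) + 1) ^ 0 with hS₀
  have hS₃0 : 0 ≤ S₃ := mul_nonneg hK₁ (Finset.sum_nonneg fun r _ => by positivity)
  have hS₂0 : 0 ≤ S₂ := mul_nonneg hK₁ (Finset.sum_nonneg fun r _ => by positivity)
  have hS₁0 : 0 ≤ S₁ := mul_nonneg hK₁ (Finset.sum_nonneg fun r _ => by positivity)
  have hS₀0 : 0 ≤ S₀ := mul_nonneg hK₀' (Finset.sum_nonneg fun r _ => by positivity)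
  refine ⟨4 * S₃ + 6 * S₂ + 4 * S₁ + S₀, by linarith, fun n => ?_⟩
  rw [sum_coeff_qMonicTwo_diff (fun m => hatC4DTwo (stripYT 2) (m + 1) a b) n]
  rw [← Complex.ofReal_natCast, ← Complex.ofReal_pow, ← Complex.ofReal_pow, ← Complex.ofReal_mul, ← Complex.ofReal_mul, ← Complex.ofReal_mul,
    ← Complex.ofReal_add, ← Complex.ofReal_add, ← Complex.ofReal_add, ← Complex.ofReal_sub, Complex.norm_real, Real.norm_eq_abs,
    hatC4D_two_source a b m₀ m₂ m₃ n, abs_neg]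
  have h3 := abs_sum_mul_shift_le_five (g := fun r => detYTwoDot (stripYT 2) r)
    (e := fun m => hatC3DTwo (stripYT 2) (m + 1) a b - (pThreeTwoDet (limTwo a b) * (m : ℝ) ^ 3 + pTwoTwoDet (limTwo a b) m₀ * (m : ℝ) ^ 2
      + pOneTwoDet (limTwo a b) m₀ m₂ * (m : ℝ) + m₃)) hR0.le hR1.le hK₁ hb₃ n
  have h2 := abs_sum_mul_shift_le_five (g := fun r => detYTwoDot (stripYT 2) r)
    (e := fun m => hatC2D (stripYT 2) (m + 1) a b - (cDetTwo ^ 2 * limTwo a b * (m : ℝ) ^ 2 + linQTwoDet (limTwo a b) m₀ * (m : ℝ) + m₂))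
    hR0.le hR1.le hK₁ hb₂ n
  have h1 := abs_sum_mul_shift_le_five (g := fun r => detYTwoDot (stripYT 2) r)
    (e := fun m => hatCD (stripYT 2) (m + 1) a b - (cDetTwo * limTwo a b * (m : ℝ) + m₀)) hR0.le hR1.le hK₁ hb₁ n
  have h0 := abs_sum_mul_shift_le_five (g := fun r => detYTwoDot (stripYT 2) r) (e := fun m => hatD 2 (stripYT 2) (m + 1) a b - limTwo a b)
    hR0.le hR1.le hK₀' (hK₀ a b) n
  rw [← hS₃] at h3
  rw [← hS₂] at h2
  rw [← hS₁] at h1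
  rw [← hS₀] at h0
  have hn1 : (1 : ℝ) ≤ (n : ℝ) + 1 := by linarith [(Nat.cast_nonneg n : (0 : ℝ) ≤ n)]
  have hp2 : ((n : ℝ) + 1) ^ 6 * rTwoDet ^ n ≤ ((n : ℝ) + 1) ^ 9 * rTwoDet ^ n :=
    mul_le_mul_of_nonneg_right (pow_le_pow_right₀ hn1 (by norm_num)) (by positivity)
  have hp1 : ((n : ℝ) + 1) ^ 3 * rTwoDet ^ n ≤ ((n : ℝ) + 1) ^ 9 * rTwoDet ^ n :=
    mul_le_mul_of_nonneg_right (pow_le_pow_right₀ hn1 (by norm_num)) (by positivity)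
  have hp0 : ((n : ℝ) + 1) ^ 0 * rTwoDet ^ n ≤ ((n : ℝ) + 1) ^ 9 * rTwoDet ^ n :=
    mul_le_mul_of_nonneg_right (pow_le_pow_right₀ hn1 (by norm_num)) (by positivity)
  have h2' := h2.trans (mul_le_mul_of_nonneg_left hp2 hS₂0)
  have h1' := h1.trans (mul_le_mul_of_nonneg_left hp1 hS₁0)
  have h0' := h0.trans (mul_le_mul_of_nonneg_left hp0 hS₀0)
  set X₃ := ∑ r ∈ range 5, detYTwoDot (stripYT 2) r * (hatC3DTwo (stripYT 2) (n + r + 1) a b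
      - (pThreeTwoDet (limTwo a b) * ((n + r : ℕ) : ℝ) ^ 3 + pTwoTwoDet (limTwo a b) m₀ * ((n + r : ℕ) : ℝ) ^ 2
        + pOneTwoDet (limTwo a b) m₀ m₂ * ((n + r : ℕ) : ℝ) + m₃)) with hX₃
  set X₂ := ∑ r ∈ range 5, detYTwoDot (stripYT 2) r * (hatC2D (stripYT 2) (n + r + 1) a b
      - (cDetTwo ^ 2 * limTwo a b * ((n + r : ℕ) : ℝ) ^ 2 + linQTwoDet (limTwo a b) m₀ * ((n + r : ℕ) : ℝ) + m₂)) with hX₂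
  set X₁ := ∑ r ∈ range 5, detYTwoDot (stripYT 2) r * (hatCD (stripYT 2) (n + r + 1) a b - (cDetTwo * limTwo a b * ((n + r : ℕ) : ℝ) + m₀)) with hX₁
  set X₀ := ∑ r ∈ range 5, detYTwoDot (stripYT 2) r * (hatD 2 (stripYT 2) (n + r + 1) a b - limTwo a b) with hX₀
  set W := ((n : ℝ) + 1) ^ 9 * rTwoDet ^ n with hW
  calc |4 * X₃ + 6 * X₂ + 4 * X₁ + X₀| ≤ |4 * X₃ + 6 * X₂ + 4 * X₁| + |X₀| := abs_add_le _ _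
    _ ≤ (|4 * X₃ + 6 * X₂| + |4 * X₁|) + |X₀| := by gcongr; exact abs_add_le _ _
    _ ≤ ((|4 * X₃| + |6 * X₂|) + |4 * X₁|) + |X₀| := by gcongr; exact abs_add_le _ _
    _ = 4 * |X₃| + 6 * |X₂| + 4 * |X₁| + |X₀| := by
        rw [abs_mul, abs_mul, abs_mul, abs_of_pos (by norm_num : (0 : ℝ) < 4), abs_of_pos (by norm_num : (0 : ℝ) < 6)]
    _ ≤ 4 * (S₃ * W) + 6 * (S₂ * W) + 4 * (S₁ * W) + S₀ * W := by gcongr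
    _ = (4 * S₃ + 6 * S₂ + 4 * S₁ + S₀) * ((n : ℝ) + 1) ^ 9 * rTwoDet ^ n := by rw [hW]; ring

/-- ★★★ **The fourth-power contact sums of `S₂` grow quartically with forced leading coefficient `c⁴A`** (errors `K(n+1)^{12}Rⁿ`): with the laws of `Ĉ`, `Ĉ²`,
`Ĉ³` of «MOMENT LAWS»/«SKEWNESS» and constants `α₄ = quartATwoDet A`, …, `δ₄ = quartDTwoDet A m₀ m₂ m₃`.
[cite: Feller1968, XIII.6; Stanley2012EC1, §4.1 Theorem 4.1.1 (iii); lane «pcv-sawmu» a-p2 g29 — own result, not in print] -/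
theorem exists_hatC4D_two_quartic (a b : Fin (2 * 2)) :
    ∃ m₀ m₂ m₃ m₄ K : ℝ,
      (∀ n : ℕ, |hatCD (stripYT 2) (n + 1) a b - (cDetTwo * limTwo a b * (n : ℝ) + m₀)| ≤ K * ((n : ℝ) + 1) ^ 3 * rTwoDet ^ n) ∧
      (∀ n : ℕ, |hatC2D (stripYT 2) (n + 1) a b - (cDetTwo ^ 2 * limTwo a b * (n : ℝ) ^ 2 + linQTwoDet (limTwo a b) m₀ * (n : ℝ) + m₂)|
        ≤ K * ((n : ℝ) + 1) ^ 6 * rTwoDet ^ n) ∧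
      (∀ n : ℕ, |hatC3DTwo (stripYT 2) (n + 1) a b - (pThreeTwoDet (limTwo a b) * (n : ℝ) ^ 3 + pTwoTwoDet (limTwo a b) m₀ * (n : ℝ) ^ 2
        + pOneTwoDet (limTwo a b) m₀ m₂ * (n : ℝ) + m₃)| ≤ K * ((n : ℝ) + 1) ^ 9 * rTwoDet ^ n) ∧
      ∀ n : ℕ, |hatC4DTwo (stripYT 2) (n + 1) a b - (quartATwoDet (limTwo a b) / 4 * (n : ℝ) ^ 4
          + (quartBTwoDet (limTwo a b) m₀ / 3 - quartATwoDet (limTwo a b) / 2) * (n : ℝ) ^ 3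
          + (quartATwoDet (limTwo a b) / 4 - quartBTwoDet (limTwo a b) m₀ / 2 + quartCTwoDet (limTwo a b) m₀ m₂ / 2) * (n : ℝ) ^ 2
          + (quartBTwoDet (limTwo a b) m₀ / 6 - quartCTwoDet (limTwo a b) m₀ m₂ / 2 + quartDTwoDet (limTwo a b) m₀ m₂ m₃) * (n : ℝ) + m₄)|
        ≤ K * ((n : ℝ) + 1) ^ 12 * rTwoDet ^ n := by
  obtain ⟨hQm, hdeg⟩ := qMonicTwo_monic
  obtain ⟨hR0, hR1, hR35, -⟩ := rTwoDet_facts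
  have hT : tOneTwo ≠ 0 := (exists_hatCD_two_linear_det a b).1
  obtain ⟨m₀, m₂, m₃, K₁, hb₁, hb₂, hb₃⟩ := exists_hatC3D_two_cubic a b
  have hK₁ : 0 ≤ K₁ := by
    have h := hb₁ 0
    simp only [Nat.cast_zero, zero_add, mul_zero, one_pow, pow_zero, mul_one] at h
    exact (abs_nonneg _).trans h
  have hb₃' : ∀ n : ℕ, |hatC3DTwo (stripYT 2) (n + 1) a b - (pThreeTwoDet (limTwo a b) * (n : ℝ) ^ 3 + pTwoTwoDet (limTwo a b) m₀ * (n : ℝ) ^ 2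
      + pOneTwoDet (limTwo a b) m₀ m₂ * (n : ℝ) + m₃)| ≤ K₁ * ((n : ℝ) + 1) ^ 9 * rTwoDet ^ n := fun n => by
    have h := hb₃ n; simp only [pThreeTwoDet, pTwoTwoDet, pOneTwoDet]; exact h
  obtain ⟨K₂, hK₂, hw⟩ := hatC4D_two_recurrence_bound a b hK₁ hb₁ hb₂ hb₃'
  set A := limTwo a b with hA
  have hα : quartATwoDet A * tOneTwo = quartSrc3TwoDet A := by rw [quartATwoDet]; field_simp
  have hβ : quartBTwoDet A m₀ * tOneTwo = quartSrc2TwoDet A m₀ - 3 * quartATwoDet A * (tTwoTwo / 2) := by rw [quartBTwoDet]; field_simp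
  have hγ : quartCTwoDet A m₀ m₂ * tOneTwo = quartSrc1TwoDet A m₀ m₂ - 3 * quartATwoDet A * (tThreeTwo / 3 + tTwoTwo / 2)
      - 2 * quartBTwoDet A m₀ * (tTwoTwo / 2) := by rw [quartCTwoDet]; field_simp
  have hδ : quartDTwoDet A m₀ m₂ m₃ * tOneTwo = quartSrc0TwoDet A m₀ m₂ m₃ - quartATwoDet A * (tFourTwo / 4 + tThreeTwo + tTwoTwo / 2)
      - quartBTwoDet A m₀ * (tThreeTwo / 3 + tTwoTwo / 2) - quartCTwoDet A m₀ m₂ * (tTwoTwo / 2) := by rw [quartDTwoDet]; field_simp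
  obtain ⟨m₄, K₃, hK₃, hb₄⟩ := Literature.Analysis.exists_abs_sub_quartic_le_of_linearRecurrence_one_real
    (w := fun m => hatC4DTwo (stripYT 2) (m + 1) a b) hQm hR0 hR1 (fun z hz => (qMonicTwo_root_norm_le hz).trans hR35)
    sum_coeff_qMonicTwo sum_coeff_mul_qMonicTwo sum_coeff_sq_qMonicTwo sum_coeff_cube_qMonicTwo hα hβ hγ hδ hK₂ hw
  refine ⟨m₀, m₂, m₃, m₄, max K₁ K₃, fun n => (hb₁ n).trans ?_, fun n => (hb₂ n).trans ?_, fun n => (hb₃' n).trans ?_, fun n => ?_⟩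
  · gcongr; exact le_max_left _ _
  · gcongr; exact le_max_left _ _
  · gcongr; exact le_max_left _ _
  have h := hb₄ n
  rw [hdeg] at h
  exact h.trans (by gcongr; exact le_max_right _ _)

end W2

end HV

end Literature.Probability.RandomPlanarGeometry.SAW
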